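import Literature.Computability.Complexity.CodeFPLists
import Literature.Computability.QuantumComplexity.CliffordGaussSums
import Mathlib.Data.Nat.Size
import HarnessLib

/-!
# The Gauss-sum evaluator on codes, I: affine forms and the closure operations

Topic `Literature/Computability/QuantumComplexity`, sub-namespace `BravyiGosset`, code layer of the
discharge of `BravyiGosset2016_estimateAcceptProb` (machine side). The list-level definitions of
`CliffordGaussSums.lean` (`AffForm.bxor/add/addConst/unit`, `addMod4`, `scaleList`, `crossRows`,
`xorRows`, `quadLin`, `GData.addPhaseForm`, `GData.addQuadProduct`) are computed on codes by
polynomial-time string functions — typed `CodeFP` facts assembled from the combinators of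
`CodeFP.lean`, `CodeFPArith.lean`, `CodeFPLists.lean`; no machine is written. Codes:

* `bitsE = rawE bitE` (coefficient lists), `affE f = ⟨[f.c], f.a⟩` (`AffForm`),
* `natsE = rawE natE`, `rowsE = rawE bitsE`, `gdE D = ⟨bin μ, ⟨Λ, B⟩⟩` (`GData`).

The padded entrywise operations of the mathematics file are identified with `CodeFP.zipWithPad`
(`bxor_eq_zipWithPad`, `addMod4_eq_zipWithPad`, `xorRows_eq_zipWithPad`).

## References

* S. Arora, B. Barak, *Computational Complexity: A Modern Approach*, CUP 2009, §1.3.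
* S. Bravyi, D. Gosset, *Improved classical simulation of quantum circuits dominated by Clifford
  gates*, Phys. Rev. Lett. 116 (2016) 250501, App. A (the data `(Q, D, J)` of a quadratic form and
  its updates, "a constant number of matrix-matrix multiplications", cost `O(k³)`).
-/

namespace Literature.Computability.QuantumComplexity.BravyiGosset

open _root_.Computability Literature.Computability.Complexity Literature.Computability.Complexity.CodeFP

/-! ### Codes -/

/-- Coefficient lists: raw lists of bits. [folklore] -/
abbrev bitsE : List Bool → List Bool := rawE bitE

/-- Affine forms: `⟨[c], a⟩`. [folklore] -/
def affE : AffForm → List Bool := fun f => pairE bitE bitsE (f.c, f.a)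

/-- Lists of small naturals (the `Λ` vector). [folklore] -/
abbrev natsE : List ℕ → List Bool := rawE natE

/-- Ragged bit matrices (the `B` rows). [folklore] -/
abbrev rowsE : List (List Bool) → List Bool := rawE bitsE

/-- Quadratic-form data: `⟨bin μ, ⟨Λ, B⟩⟩`. [folklore] -/
def gdE : GData → List Bool := fun D => pairE natE (pairE natsE rowsE) (D.mu, D.lam, D.B)

/-- `affE` is injective. [folklore] -/
theorem affE_injective : Function.Injective affE := by
  intro f g h
  have := pairE_injective bitE_injective (rawE_injective bitE_injective) h
  obtain ⟨h1, h2⟩ := Prod.mk.inj this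
  cases f; cases g; simp_all

/-! ### Affine forms -/

/-- The constant bit. [folklore] -/
theorem affC : CodeFP affE bitE (fun f => f.c) :=
  (fst bitE bitsE).comp (transparent (eα := affE) (eβ := pairE bitE bitsE) (g := fun f => (f.c, f.a)) fun _ => rfl)

/-- The coefficient list. [folklore] -/
theorem affA : CodeFP affE bitsE (fun f => f.a) :=
  (snd bitE bitsE).comp (transparent (eα := affE) (eβ := pairE bitE bitsE) (g := fun f => (f.c, f.a)) fun _ => rfl)

/-- Assembling a form. [folklore] -/
theorem affMk : CodeFP (pairE bitE bitsE) affE (fun p => (⟨p.1, p.2⟩ : AffForm)) :=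
  transparent fun _ => rfl

/-- `bxor` is the padded `zipWith` of `xor`. [folklore] -/
theorem bxor_eq_zipWithPad (u v : List Bool) : AffForm.bxor u v = zipWithPad (fun x y => (x ^^ y)) false false u v := by
  apply List.ext_getElem
  · rw [AffForm.length_bxor, length_zipWithPad]
  · intro j h1 h2
    have hj : j < max u.length v.length := by rwa [AffForm.length_bxor] at h1
    have e1 := AffForm.getD_bxor u v j
    have e2 := getD_zipWithPad (fun x y => (x ^^ y)) false false u v j false hj
    rw [List.getD_eq_getElem _ _ h1] at e1
    rw [List.getD_eq_getElem _ _ h2] at e2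
    rw [e1, e2]

/-- `bxor` on codes. [folklore] -/
theorem bxor_codeFP : CodeFP (pairE bitsE bitsE) bitsE (fun p => AffForm.bxor p.1 p.2) := by
  have hg : CodeFP (pairE unitE (pairE bitE bitE)) bitE (fun t => (t.2.1 ^^ t.2.2)) :=
    CodeFP.xor (snd unitE (pairE bitE bitE)).fst' (snd unitE (pairE bitE bitE)).snd'
  have hz := zipWithPadCtx (σ := Unit) (eσ := unitE) (eα := bitE) (eβ := bitE) (eγ := bitE)
    (dα := fun _ => false) (dβ := fun _ => false) hg (const unitE false) (const unitE false)
  exact ((hz.comp ((const (pairE bitsE bitsE) ()).pair (CodeFP.id (pairE bitsE bitsE)))).congr fun p => by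
    rw [bxor_eq_zipWithPad]; rfl)

/-- `AffForm.add` on codes. [folklore] -/
theorem affAdd : CodeFP (pairE affE affE) affE (fun p => p.1.add p.2) := by
  have hc : CodeFP (pairE affE affE) bitE (fun p => (p.1.c ^^ p.2.c)) :=
    CodeFP.xor (affC.comp (fst affE affE)) (affC.comp (snd affE affE))
  have ha : CodeFP (pairE affE affE) bitsE (fun p => AffForm.bxor p.1.a p.2.a) := by
    exact (bxor_codeFP.comp ((affA.comp (fst affE affE)).pair (affA.comp (snd affE affE))) :)
  exact (affMk.comp (hc.pair ha)).congr fun p => rfl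

/-- `AffForm.addConst` on codes. [folklore] -/
theorem affAddConst : CodeFP (pairE affE bitE) affE (fun p => p.1.addConst p.2) := by
  have hc : CodeFP (pairE affE bitE) bitE (fun p => (p.1.c ^^ p.2)) :=
    CodeFP.xor (affC.comp (fst affE bitE)) (snd affE bitE)
  have ha : CodeFP (pairE affE bitE) bitsE (fun p => p.1.a) := affA.comp (fst affE bitE)
  exact (affMk.comp (hc.pair ha)).congr fun p => rfl

/-- `AffForm.unit j` on codes, for a unary `j`. [folklore] -/
theorem affUnit : CodeFP unE affE (fun j => AffForm.unit j) := by
  have hr : CodeFP unE bitsE (fun j => List.replicate j false) := by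
    exact ((replicateOf bitE).comp ((const unE false).pair (CodeFP.id unE)) :)
  have ha : CodeFP unE bitsE (fun j => List.replicate j false ++ [true]) := by
    exact ((rawAppend bitE).comp (hr.pair ((rawSingleton bitE).comp (const unE true))) :)
  exact (affMk.comp ((const unE false).pair ha)).congr fun j => rfl

/-- `AffForm.const c` on codes. [folklore] -/
theorem affConst : CodeFP bitE affE (fun c => AffForm.const c) :=
  (affMk.comp ((CodeFP.id bitE).pair (const bitE ([] : List Bool)))).congr fun _ => rfl

/-! ### `Λ`-vectors -/

/-- `addMod4` is the padded `zipWith` of `(x + y) mod 4`. [folklore] -/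
theorem addMod4_eq_zipWithPad (u v : List ℕ) : addMod4 u v = zipWithPad (fun x y => (x + y) % 4) 0 0 u v := by
  apply List.ext_getElem
  · rw [length_addMod4, length_zipWithPad]
  · intro j h1 h2
    have hj : j < max u.length v.length := by rwa [length_addMod4] at h1
    have e1 := getD_addMod4 u v j
    have e2 := getD_zipWithPad (fun x y => (x + y) % 4) 0 0 u v j 0 hj
    rw [List.getD_eq_getElem _ _ h1] at e1
    rw [List.getD_eq_getElem _ _ h2] at e2
    rw [e1, e2]

/-- `addMod4` on codes. [folklore] -/
theorem addMod4_codeFP : CodeFP (pairE natsE natsE) natsE (fun p => addMod4 p.1 p.2) := by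
  have hsum : CodeFP (pairE unitE (pairE natE natE)) natE (fun t => t.2.1 + t.2.2) :=
    natAdd.comp ((snd unitE (pairE natE natE)).fst'.pair (snd unitE (pairE natE natE)).snd')
  have hg : CodeFP (pairE unitE (pairE natE natE)) natE (fun t => (t.2.1 + t.2.2) % 4) := by
    exact (natMod.comp (hsum.pair (const _ 4)) :)
  have hz := zipWithPadCtx (σ := Unit) (eσ := unitE) (eα := natE) (eβ := natE) (eγ := natE)
    (dα := fun _ => 0) (dβ := fun _ => 0) hg (const unitE 0) (const unitE 0)
  exact ((hz.comp ((const (pairE natsE natsE) ()).pair (CodeFP.id (pairE natsE natsE)))).congr fun p => by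
    rw [addMod4_eq_zipWithPad]; rfl)

/-- `scaleList s a` on codes. [folklore] -/
theorem scaleList_codeFP : CodeFP (pairE natE bitsE) natsE (fun p => scaleList p.1 p.2) := by
  have hg : CodeFP (pairE natE bitE) natE (fun t => if t.2 then t.1 % 4 else 0) :=
    (snd natE bitE).ite (natMod.comp ((fst natE bitE).pair (const _ 4))) (const _ 0)
  exact ((map (σ := ℕ) (α := Bool) (g := fun t => if t.2 then t.1 % 4 else 0) hg)).congr fun p => rfl

/-! ### Bit matrices -/

/-- `crossRows u v` on codes. [folklore] -/
theorem crossRows_codeFP : CodeFP (pairE bitsE bitsE) rowsE (fun p => crossRows p.1 p.2) := by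
  -- context `(u, v)`, outer item `i`, inner item `j`
  let ctxE : List Bool × List Bool → List Bool := pairE bitsE bitsE
  have hbit : CodeFP (pairE (pairE ctxE natE) natE) bitE
      (fun t => (t.1.1.1.getD t.1.2 false && t.1.1.2.getD t.2 false)) := by
    have hu : CodeFP (pairE (pairE ctxE natE) natE) bitE (fun t => t.1.1.1.getD t.1.2 false) := by
      exact ((rawGetOr bitE).comp ((fst (pairE ctxE natE) natE).fst'.fst'.pair
        (((fst (pairE ctxE natE) natE).snd').pair (const _ false))) :)
    have hv : CodeFP (pairE (pairE ctxE natE) natE) bitE (fun t => t.1.1.2.getD t.2 false) := by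
      exact ((rawGetOr bitE).comp ((fst (pairE ctxE natE) natE).fst'.snd'.pair
        ((snd (pairE ctxE natE) natE).pair (const _ false))) :)
    exact hu.and hv
  have hinner : CodeFP (pairE ctxE natE) bitsE
      (fun s => (List.range (min s.2 s.1.1.length)).map fun j => (s.1.1.getD s.2 false && s.1.2.getD j false)) := by
    have hr : CodeFP (pairE ctxE natE) (rawE natE) (fun s => List.range (min s.2 s.1.1.length)) := by
      exact (rangeOf.comp ((((ulength bitE).comp (fst ctxE natE).fst')).pair (snd ctxE natE)) :)
    exact ((map hbit).comp ((CodeFP.id (pairE ctxE natE)).pair hr) :)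
  have houter : CodeFP ctxE rowsE
      (fun c => (List.range c.1.length).map fun i =>
        (List.range (min i c.1.length)).map fun j => (c.1.getD i false && c.2.getD j false)) := by
    have hlen : CodeFP ctxE unE (fun c => c.1.length) := (ulength bitE).comp (fst bitsE bitsE)
    have hr : CodeFP ctxE (rawE natE) (fun c => List.range c.1.length) := urange.comp hlen
    exact ((map hinner).comp ((CodeFP.id ctxE).pair hr) :)
  refine houter.congr fun c => ?_
  unfold crossRows
  refine List.map_congr_left fun i hi => ?_
  rw [min_eq_left (List.mem_range.1 hi).le]

/-- `xorRows` is the padded `zipWith` of `bxor` with empty rows as defaults. [folklore] -/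
theorem xorRows_eq_zipWithPad (U V : List (List Bool)) : xorRows U V = zipWithPad AffForm.bxor [] [] U V := by
  apply List.ext_getElem
  · rw [length_xorRows, length_zipWithPad]
  · intro i h1 h2
    have hi : i < max U.length V.length := by rwa [length_xorRows] at h1
    have e1 := getD_xorRows U V i
    have e2 := getD_zipWithPad AffForm.bxor [] [] U V i [] hi
    rw [List.getD_eq_getElem _ _ h1] at e1
    rw [List.getD_eq_getElem _ _ h2] at e2
    rw [e1, e2]

/-- `xorRows` on codes. [folklore] -/
theorem xorRows_codeFP : CodeFP (pairE rowsE rowsE) rowsE (fun p => xorRows p.1 p.2) := by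
  have hg : CodeFP (pairE unitE (pairE bitsE bitsE)) bitsE (fun t => AffForm.bxor t.2.1 t.2.2) :=
    bxor_codeFP.comp (snd unitE (pairE bitsE bitsE))
  have hz := zipWithPadCtx (σ := Unit) (eσ := unitE) (eα := bitsE) (eβ := bitsE) (eγ := bitsE)
    (dα := fun _ => ([] : List Bool)) (dβ := fun _ => ([] : List Bool)) hg (const unitE []) (const unitE [])
  exact ((hz.comp ((const (pairE rowsE rowsE) ()).pair (CodeFP.id (pairE rowsE rowsE)))).congr fun p => by
    rw [xorRows_eq_zipWithPad]; rfl)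

/-! ### The closure operations -/

/-- The three components of the data. [folklore] -/
theorem gdMu : CodeFP gdE natE (fun D => D.mu) :=
  (fst natE (pairE natsE rowsE)).comp (transparent (eα := gdE) (eβ := pairE natE (pairE natsE rowsE))
    (g := fun D => (D.mu, D.lam, D.B)) fun _ => rfl)

/-- The three components of the data. [folklore] -/
theorem gdLam : CodeFP gdE natsE (fun D => D.lam) :=
  (snd natE (pairE natsE rowsE)).fst'.comp (transparent (eα := gdE) (eβ := pairE natE (pairE natsE rowsE))
    (g := fun D => (D.mu, D.lam, D.B)) fun _ => rfl)

/-- The three components of the data. [folklore] -/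
theorem gdB : CodeFP gdE rowsE (fun D => D.B) :=
  (snd natE (pairE natsE rowsE)).snd'.comp (transparent (eα := gdE) (eβ := pairE natE (pairE natsE rowsE))
    (g := fun D => (D.mu, D.lam, D.B)) fun _ => rfl)

/-- Assembling the data. [folklore] -/
theorem gdMk : CodeFP (pairE natE (pairE natsE rowsE)) gdE (fun p => (⟨p.1, p.2.1, p.2.2⟩ : GData)) :=
  transparent fun _ => rfl

/-- The argument code of `addPhaseForm`: `(κ, f, D)`. [folklore] -/
abbrev apfE : ℕ × AffForm × GData → List Bool := pairE natE (pairE affE gdE)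

/-- **`addPhaseForm` on codes.** [cite: BravyiGosset2016, App. A (updates of (Q, D, J))] -/
theorem addPhaseForm_codeFP : CodeFP apfE gdE (fun p => GData.addPhaseForm p.1 p.2.1 p.2.2) := by
  have hκ : CodeFP apfE natE (fun p => p.1) := fst natE (pairE affE gdE)
  have hf : CodeFP apfE affE (fun p => p.2.1) := (snd natE (pairE affE gdE)).fst'
  have hD : CodeFP apfE gdE (fun p => p.2.2) := (snd natE (pairE affE gdE)).snd'
  have hc : CodeFP apfE natE (fun p => Bool.toNat p.2.1.c) := by
    exact ((affC.comp hf).ite (const _ 1) (const _ 0)).congr fun p => by cases p.2.1.c <;> rfl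
  have hmu : CodeFP apfE natE (fun p => (p.2.2.mu + p.1 * Bool.toNat p.2.1.c) % 4) := by
    exact (natMod.comp ((natAdd.comp ((gdMu.comp hD).pair (natMul.comp (hκ.pair hc)))).pair (const _ 4)) :)
  have hs : CodeFP apfE natE (fun p => p.1 * (1 + 2 * Bool.toNat p.2.1.c)) := by
    exact (natMul.comp (hκ.pair (natAdd.comp ((const _ 1).pair (natMul.comp ((const _ 2).pair hc))))) :)
  have hlam : CodeFP apfE natsE (fun p => addMod4 p.2.2.lam (scaleList (p.1 * (1 + 2 * Bool.toNat p.2.1.c)) p.2.1.a)) := by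
    exact (addMod4_codeFP.comp ((gdLam.comp hD).pair (scaleList_codeFP.comp (hs.pair (affA.comp hf)))) :)
  have hodd : CodeFP apfE bitE (fun p => decide (p.1 % 2 = 1)) := by
    exact (natEq.comp ((natMod.comp (hκ.pair (const _ 2))).pair (const _ 1)) :)
  have hBx : CodeFP apfE rowsE (fun p => xorRows p.2.2.B (crossRows p.2.1.a p.2.1.a)) := by
    exact (xorRows_codeFP.comp ((gdB.comp hD).pair (crossRows_codeFP.comp ((affA.comp hf).pair (affA.comp hf)))) :)
  have hB : CodeFP apfE rowsE (fun p => if decide (p.1 % 2 = 1) then xorRows p.2.2.B (crossRows p.2.1.a p.2.1.a) else p.2.2.B) :=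
    hodd.ite hBx (gdB.comp hD)
  refine (gdMk.comp (hmu.pair (hlam.pair hB))).congr fun p => ?_
  unfold GData.addPhaseForm
  simp only [decide_eq_true_eq]

/-- The argument code of `addQuadProduct`: `(f, g, D)`. [folklore] -/
abbrev aqpE : AffForm × AffForm × GData → List Bool := pairE affE (pairE affE gdE)

/-- `quadLin f g` on codes. [folklore] -/
theorem quadLin_codeFP : CodeFP (pairE affE affE) natsE (fun p => GData.quadLin p.1 p.2) := by
  let cE : AffForm × AffForm → List Bool := pairE affE affE
  -- the item map with context `(f, g)` and item `j`
  have hf : CodeFP (pairE cE natE) affE (fun t => t.1.1) := (fst cE natE).fst'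
  have hg : CodeFP (pairE cE natE) affE (fun t => t.1.2) := (fst cE natE).snd'
  have hj : CodeFP (pairE cE natE) natE (fun t => t.2) := snd cE natE
  have hfj : CodeFP (pairE cE natE) bitE (fun t => t.1.1.a.getD t.2 false) := by
    exact ((rawGetOr bitE).comp ((affA.comp hf).pair (hj.pair (const _ false))) :)
  have hgj : CodeFP (pairE cE natE) bitE (fun t => t.1.2.a.getD t.2 false) := by
    exact ((rawGetOr bitE).comp ((affA.comp hg).pair (hj.pair (const _ false))) :)
  have toN : ∀ {q : (AffForm × AffForm) × ℕ → Bool}, CodeFP (pairE cE natE) bitE q →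
      CodeFP (pairE cE natE) natE (fun t => Bool.toNat (q t)) := fun {q} hq =>
    (hq.ite (const _ 1) (const _ 0)).congr fun t => by cases q t <;> rfl
  have h1 : CodeFP (pairE cE natE) natE (fun t => Bool.toNat (t.1.1.c && t.1.2.a.getD t.2 false)) :=
    toN ((affC.comp hf).and hgj)
  have h2 : CodeFP (pairE cE natE) natE (fun t => Bool.toNat (t.1.2.c && t.1.1.a.getD t.2 false)) :=
    toN ((affC.comp hg).and hfj)
  have h3 : CodeFP (pairE cE natE) natE (fun t => Bool.toNat (t.1.1.a.getD t.2 false && t.1.2.a.getD t.2 false)) :=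
    toN (hfj.and hgj)
  have hitem : CodeFP (pairE cE natE) natE (fun t => 2 * (Bool.toNat (t.1.1.c && t.1.2.a.getD t.2 false) +
      Bool.toNat (t.1.2.c && t.1.1.a.getD t.2 false) + Bool.toNat (t.1.1.a.getD t.2 false && t.1.2.a.getD t.2 false)) % 4) := by
    exact (natMod.comp ((natMul.comp ((const _ 2).pair (natAdd.comp ((natAdd.comp (h1.pair h2)).pair h3)))).pair (const _ 4)) :)
  have hmax : CodeFP cE unE (fun c => max c.1.a.length c.2.a.length) := by
    exact ((unMaxLen bitE bitE).comp ((affA.comp (fst affE affE)).pair (affA.comp (snd affE affE))) :)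
  have hr : CodeFP cE (rawE natE) (fun c => List.range (max c.1.a.length c.2.a.length)) := urange.comp hmax
  have hall : CodeFP cE natsE (fun c => (List.range (max c.1.a.length c.2.a.length)).map fun j =>
      2 * (Bool.toNat (c.1.c && c.2.a.getD j false) + Bool.toNat (c.2.c && c.1.a.getD j false) +
        Bool.toNat (c.1.a.getD j false && c.2.a.getD j false)) % 4) := by
    exact ((map hitem).comp ((CodeFP.id cE).pair hr) :)
  exact hall.congr fun c => rfl

/-- **`addQuadProduct` on codes.** [cite: BravyiGosset2016, App. A (updates of (Q, D, J))] -/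
theorem addQuadProduct_codeFP : CodeFP aqpE gdE (fun p => GData.addQuadProduct p.1 p.2.1 p.2.2) := by
  have hf : CodeFP aqpE affE (fun p => p.1) := fst affE (pairE affE gdE)
  have hg : CodeFP aqpE affE (fun p => p.2.1) := (snd affE (pairE affE gdE)).fst'
  have hD : CodeFP aqpE gdE (fun p => p.2.2) := (snd affE (pairE affE gdE)).snd'
  have hcd : CodeFP aqpE natE (fun p => Bool.toNat (p.1.c && p.2.1.c)) := by
    exact ((((affC.comp hf).and (affC.comp hg))).ite (const _ 1) (const _ 0)).congr fun p => by
      cases (p.1.c && p.2.1.c) <;> rfl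
  have hmu : CodeFP aqpE natE (fun p => (p.2.2.mu + 2 * Bool.toNat (p.1.c && p.2.1.c)) % 4) := by
    exact (natMod.comp ((natAdd.comp ((gdMu.comp hD).pair (natMul.comp ((const _ 2).pair hcd)))).pair (const _ 4)) :)
  have hlam : CodeFP aqpE natsE (fun p => addMod4 p.2.2.lam (GData.quadLin p.1 p.2.1)) := by
    exact (addMod4_codeFP.comp ((gdLam.comp hD).pair (quadLin_codeFP.comp (hf.pair hg))) :)
  have hB : CodeFP aqpE rowsE (fun p => xorRows p.2.2.B (xorRows (crossRows p.1.a p.2.1.a) (crossRows p.2.1.a p.1.a))) := by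
    exact (xorRows_codeFP.comp ((gdB.comp hD).pair (xorRows_codeFP.comp
      ((crossRows_codeFP.comp ((affA.comp hf).pair (affA.comp hg))).pair
        (crossRows_codeFP.comp ((affA.comp hg).pair (affA.comp hf)))))) :)
  exact (gdMk.comp (hmu.pair (hlam.pair hB))).congr fun p => rfl


/-! ### Reading the data -/

/-- `lamAt` on codes. [folklore] -/
theorem lamAt_codeFP : CodeFP (pairE gdE natE) natE (fun t => t.1.lamAt t.2) := by
  exact ((rawGetOr natE).comp ((gdLam.comp (fst gdE natE)).pair ((snd gdE natE).pair (const _ 0))) :)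

/-- `entry` on codes. [folklore] -/
theorem entry_codeFP : CodeFP (pairE gdE (pairE natE natE)) bitE (fun t => t.1.entry t.2.1 t.2.2) := by
  have hrow : CodeFP (pairE gdE (pairE natE natE)) bitsE (fun t => t.1.B.getD t.2.1 []) := by
    exact ((rawGetOr bitsE).comp ((gdB.comp (fst gdE (pairE natE natE))).pair
      (((snd gdE (pairE natE natE)).fst').pair (const _ ([] : List Bool)))) :)
  exact ((rawGetOr bitE).comp (hrow.pair (((snd gdE (pairE natE natE)).snd').pair (const _ false)))).congr
    fun t => rfl

/-- `addMu e D` on codes (argument `(e, D)`). [folklore] -/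
theorem addMu_codeFP : CodeFP (pairE natE gdE) gdE (fun t => GData.addMu t.1 t.2) := by
  have hmu : CodeFP (pairE natE gdE) natE (fun t => (t.2.mu + t.1) % 4) := by
    exact (natMod.comp ((natAdd.comp ((gdMu.comp (snd natE gdE)).pair (fst natE gdE))).pair (const _ 4)) :)
  exact (gdMk.comp (hmu.pair ((gdLam.comp (snd natE gdE)).pair (gdB.comp (snd natE gdE))))).congr fun t => rfl

/-- `restrict k D` on codes, `k` unary (argument `(1ᵏ, D)`). [folklore] -/
theorem restrict_codeFP : CodeFP (pairE unE gdE) gdE (fun t => GData.restrict t.1 t.2) := by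
  have hmu : CodeFP (pairE unE gdE) natE (fun t => t.2.mu % 4) := by
    exact (natMod.comp ((gdMu.comp (snd unE gdE)).pair (const _ 4)) :)
  have hlam : CodeFP (pairE unE gdE) natsE (fun t => t.2.lam.take t.1) := by
    exact ((rawTakeUn natE).comp ((fst unE gdE).pair (gdLam.comp (snd unE gdE))) :)
  have hB : CodeFP (pairE unE gdE) rowsE (fun t => t.2.B.take t.1) := by
    exact ((rawTakeUn bitsE).comp ((fst unE gdE).pair (gdB.comp (snd unE gdE))) :)
  exact (gdMk.comp (hmu.pair (hlam.pair hB))).congr fun t => rfl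

/-- The couplings of variable `k` (unary) to the variables `j < k`: the list
`[B_{k0}, …, B_{k,k-1}]` (argument `(1ᵏ, D)`). [folklore] -/
theorem lastRow_codeFP : CodeFP (pairE unE gdE) bitsE (fun t => (List.range t.1).map fun j => t.2.entry t.1 j) := by
  let cE : ℕ × GData → List Bool := pairE unE gdE
  have hk : CodeFP (pairE cE natE) natE (fun s => s.1.1) := natOfUn.comp (fst cE natE).fst'
  have hitem : CodeFP (pairE cE natE) bitE (fun s => s.1.2.entry s.1.1 s.2) := by
    exact (entry_codeFP.comp (((fst cE natE).snd').pair (hk.pair (snd cE natE))) :)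
  have hr : CodeFP cE (rawE natE) (fun c => List.range c.1) := urange.comp (fst unE gdE)
  exact ((map hitem).comp ((CodeFP.id cE).pair hr)).congr fun c => rfl

/-- `colrow k p D` on codes (argument `(1ᵏ, p, D)`). [folklore] -/
theorem colrow_codeFP : CodeFP (pairE unE (pairE natE gdE)) affE (fun t => GData.colrow t.1 t.2.1 t.2.2) := by
  let cE : ℕ × ℕ × GData → List Bool := pairE unE (pairE natE gdE)
  have hp : CodeFP (pairE cE natE) natE (fun s => s.1.2.1) := (fst cE natE).snd'.fst'
  have hD : CodeFP (pairE cE natE) gdE (fun s => s.1.2.2) := (fst cE natE).snd'.snd'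
  have hj : CodeFP (pairE cE natE) natE (fun s => s.2) := snd cE natE
  have h1 : CodeFP (pairE cE natE) bitE (fun s => s.1.2.2.entry s.1.2.1 s.2) := by
    exact (entry_codeFP.comp (hD.pair (hp.pair hj)) :)
  have h2 : CodeFP (pairE cE natE) bitE (fun s => s.1.2.2.entry s.2 s.1.2.1) := by
    exact (entry_codeFP.comp (hD.pair (hj.pair hp)) :)
  have hlt : CodeFP (pairE cE natE) bitE (fun s => decide (s.2 < s.1.2.1)) := natLt.comp (hj.pair hp)
  have heq : CodeFP (pairE cE natE) bitE (fun s => decide (s.2 = s.1.2.1)) := natEq.comp (hj.pair hp)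
  have hitem : CodeFP (pairE cE natE) bitE
      (fun s => if decide (s.2 < s.1.2.1) then s.1.2.2.entry s.1.2.1 s.2 else
        if decide (s.2 = s.1.2.1) then false else s.1.2.2.entry s.2 s.1.2.1) :=
    hlt.ite h1 (heq.ite (const _ false) h2)
  have hr : CodeFP cE (rawE natE) (fun c => List.range c.1) := urange.comp (fst unE (pairE natE gdE))
  have hlist : CodeFP cE bitsE (fun c => (List.range c.1).map fun j =>
      if decide (j < c.2.1) then c.2.2.entry c.2.1 j else if decide (j = c.2.1) then false else c.2.2.entry j c.2.1) := by
    exact ((map hitem).comp ((CodeFP.id cE).pair hr) :)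
  refine (affMk.comp ((const cE false).pair hlist)).congr fun c => ?_
  unfold GData.colrow
  simp only [decide_eq_true_eq]

/-- `zeroVar p D` on codes (argument `(p, D)`). [folklore] -/
theorem zeroVar_codeFP : CodeFP (pairE natE gdE) gdE (fun t => GData.zeroVar t.1 t.2) := by
  let cE : ℕ × GData → List Bool := pairE natE gdE
  have hp : CodeFP cE natE (fun c => c.1) := fst natE gdE
  have hD : CodeFP cE gdE (fun c => c.2) := snd natE gdE
  have hlam : CodeFP cE natsE (fun c => c.2.lam.set c.1 0) := by
    exact ((setAt natE).comp ((gdLam.comp hD).pair (hp.pair (const _ 0))) :)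
  -- the row map, context `p`, item `(l, row)`
  let iE : ℕ × ℕ × List Bool → List Bool := pairE natE (pairE natE bitsE)
  have ip : CodeFP iE natE (fun s => s.1) := fst natE (pairE natE bitsE)
  have il : CodeFP iE natE (fun s => s.2.1) := (snd natE (pairE natE bitsE)).fst'
  have irow : CodeFP iE bitsE (fun s => s.2.2) := (snd natE (pairE natE bitsE)).snd'
  have hset : CodeFP iE bitsE (fun s => s.2.2.set s.1 false) := by
    exact ((setAt bitE).comp (irow.pair (ip.pair (const _ false))) :)
  have hrowf : CodeFP iE bitsE (fun s => if decide (s.2.1 = s.1) then [] else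
      if decide (s.1 < s.2.1) then s.2.2.set s.1 false else s.2.2) :=
    (natEq.comp (il.pair ip)).ite (const _ []) ((natLt.comp (ip.pair il)).ite hset irow)
  have hB : CodeFP cE rowsE (fun c => c.2.B.mapIdx fun l row =>
      if decide (l = c.1) then [] else if decide (c.1 < l) then row.set c.1 false else row) := by
    exact ((mapIdx hrowf).comp (hp.pair (gdB.comp hD)) :)
  refine (gdMk.comp ((gdMu.comp hD).pair (hlam.pair hB))).congr fun c => ?_
  unfold GData.zeroVar
  simp only [decide_eq_true_eq]

/-! ### The first `true` entry as a fold -/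

/-- The step of the search for the first `true`: `(count, found)`. [folklore] -/
def ftStep (st : ℕ × Bool) (b : Bool) : ℕ × Bool :=
  if st.2 then st else if b then (st.1, true) else (st.1 + 1, false)

/-- The fold from a found state stays. [folklore] -/
theorem foldl_ftStep_true (l : List Bool) (n : ℕ) : l.foldl ftStep (n, true) = (n, true) := by
  induction l with
  | nil => rfl
  | cons b l ih => rw [List.foldl_cons]; exact ih

/-- The fold computes `firstTrue` (shifted by the initial count). [folklore] -/
theorem foldl_ftStep (l : List Bool) (n : ℕ) : (l.foldl ftStep (n, false)).1 = n + firstTrue l := by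
  induction l generalizing n with
  | nil => simp [firstTrue]
  | cons b l ih =>
    rw [List.foldl_cons]
    cases b
    · show (l.foldl ftStep (n + 1, false)).1 = n + (firstTrue l + 1)
      rw [ih]; omega
    · show (l.foldl ftStep (n, true)).1 = n + 0
      rw [foldl_ftStep_true]; rfl

/-- The count never exceeds the initial count plus the length. [folklore] -/
theorem foldl_ftStep_le (l : List Bool) (st : ℕ × Bool) : (l.foldl ftStep st).1 ≤ st.1 + l.length := by
  induction l generalizing st with
  | nil => simp
  | cons b l ih =>
    rw [List.foldl_cons]
    refine (ih _).trans ?_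
    unfold ftStep
    split
    · simp
    · split
      · simp
      · simp; omega

/-- **`firstTrue` on codes.** [folklore] -/
theorem firstTrue_codeFP : CodeFP bitsE natE firstTrue := by
  have hstep : CodeFP (pairE bitE (pairE natE bitE)) (pairE natE bitE) (fun t => ftStep t.2 t.1) := by
    have hb : CodeFP (pairE bitE (pairE natE bitE)) bitE (fun t => t.1) := fst bitE (pairE natE bitE)
    have hn : CodeFP (pairE bitE (pairE natE bitE)) natE (fun t => t.2.1) := (snd bitE (pairE natE bitE)).fst'
    have hf : CodeFP (pairE bitE (pairE natE bitE)) bitE (fun t => t.2.2) := (snd bitE (pairE natE bitE)).snd'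
    have hst : CodeFP (pairE bitE (pairE natE bitE)) (pairE natE bitE) (fun t => t.2) := snd bitE (pairE natE bitE)
    have h1 : CodeFP (pairE bitE (pairE natE bitE)) (pairE natE bitE) (fun t => (t.2.1, true)) := hn.pair (const _ true)
    have h2 : CodeFP (pairE bitE (pairE natE bitE)) (pairE natE bitE) (fun t => (t.2.1 + 1, false)) :=
      (natAdd.comp (hn.pair (const _ 1))).pair (const _ false)
    exact (hf.ite hst (hb.ite h1 h2)).congr fun t => rfl
  have h := foldl₀ (eα := bitE) (eβ := pairE natE bitE) (step := fun b st => ftStep st b) (b₀ := ((0 : ℕ), false))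
    hstep (2 * Polynomial.X + 8) (fun l₁ l₂ => ?_)
  · exact (h.fst').congr fun l => by
      show (l.foldl ftStep (0, false)).1 = firstTrue l
      rw [foldl_ftStep, Nat.zero_add]
  · have hle := foldl_ftStep_le l₁ (0, false)
    simp only [Nat.zero_add] at hle
    rw [Polynomial.eval_add, Polynomial.eval_mul, Polynomial.eval_X, Polynomial.eval_ofNat, Polynomial.eval_ofNat,
      pairE_apply, length_boolPair]
    have h1 : (natE (l₁.foldl ftStep (0, false)).1).length ≤ l₁.length := (length_natE_le _).trans hle
    have h2 : l₁.length ≤ (rawE bitE (l₁ ++ l₂)).length :=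
      ((List.sublist_append_left l₁ l₂).length_le).trans (length_le_length_rawE _ _)
    have h3 : (bitE (l₁.foldl ftStep (0, false)).2).length = 1 := rfl
    show 2 * (natE (List.foldl ftStep (0, false) l₁).1).length + 2 + (bitE (List.foldl ftStep (0, false) l₁).2).length ≤ _
    omega


/-! ### Multipliers -/

/-- The numeral of a multiplier. [folklore] -/
def Mult.code : Mult → ℕ
  | .zero => 0
  | .one => 1
  | .two => 2
  | .onePlusI => 3

/-- The code of a multiplier: its numeral in binary. [folklore] -/
def multE : Mult → List Bool := fun m => natE m.code

/-- A multiplier as an integer pair. [folklore] -/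
def Mult.toZg : Mult → ℤ × ℤ
  | .zero => (0, 0)
  | .one => (1, 0)
  | .two => (2, 0)
  | .onePlusI => (1, 1)

/-- `toZg` is the pair of `toZi`. [folklore] -/
theorem Mult.toZg_eq (m : Mult) : m.toZg = zgOf m.toZi := by
  cases m <;> rfl

/-- The numeral of a multiplier on codes. [folklore] -/
theorem multCode_codeFP : CodeFP multE natE Mult.code := transparent fun _ => rfl

/-- `Mult.toZg` on codes. [folklore] -/
theorem multToZg_codeFP : CodeFP multE zgE Mult.toZg := by
  have h0 : CodeFP multE bitE (fun m => decide (m.code = 0)) := natEq.comp (multCode_codeFP.pair (const _ 0))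
  have h1 : CodeFP multE bitE (fun m => decide (m.code = 1)) := natEq.comp (multCode_codeFP.pair (const _ 1))
  have h2 : CodeFP multE bitE (fun m => decide (m.code = 2)) := natEq.comp (multCode_codeFP.pair (const _ 2))
  exact (h0.ite (const _ ((0 : ℤ), (0 : ℤ))) (h1.ite (const _ ((1 : ℤ), (0 : ℤ)))
    (h2.ite (const _ ((2 : ℤ), (0 : ℤ))) (const _ ((1 : ℤ), (1 : ℤ)))))).congr fun m => by cases m <;> rfl

/-! ### One elimination step on codes -/

/-- The argument code of `elimStep`: `(1ᵏ, D)`. [folklore] -/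
abbrev esE : ℕ × GData → List Bool := pairE unE gdE

/-- **`elimStep` on codes** (output `(multiplier, data)`). [cite: BravyiGosset2016, App. A (ExponentialSum)] -/
theorem elimStep_codeFP : CodeFP esE (pairE multE gdE) (fun t => GData.elimStep t.1 t.2) := by
  have hkU : CodeFP esE unE (fun t => t.1) := fst unE gdE
  have hk : CodeFP esE natE (fun t => t.1) := by exact (natOfUn.comp hkU :)
  have hD : CodeFP esE gdE (fun t => t.2) := snd unE gdE
  have hlam : CodeFP esE natE (fun t => t.2.lamAt t.1) := by exact (lamAt_codeFP.comp (hD.pair hk) :)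
  have hb : CodeFP esE bitsE (fun t => (List.range t.1).map fun j => t.2.entry t.1 j) := lastRow_codeFP
  have hD₀ : CodeFP esE gdE (fun t => GData.restrict t.1 t.2) := restrict_codeFP
  have hodd : CodeFP esE bitE (fun t => decide (t.2.lamAt t.1 % 2 = 1)) := by
    exact (natEq.comp ((natMod.comp (hlam.pair (const _ 2))).pair (const _ 1)) :)
  have hthree : CodeFP esE bitE (fun t => decide (t.2.lamAt t.1 % 4 = 3)) := by
    exact (natEq.comp ((natMod.comp (hlam.pair (const _ 4))).pair (const _ 3)) :)
  have htwo : CodeFP esE bitE (fun t => decide (t.2.lamAt t.1 % 4 = 2)) := by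
    exact (natEq.comp ((natMod.comp (hlam.pair (const _ 4))).pair (const _ 2)) :)
  have he0 : CodeFP esE natE (fun t => if decide (t.2.lamAt t.1 % 4 = 3) then 3 else 0) := hthree.ite (const _ 3) (const _ 0)
  have he1 : CodeFP esE natE (fun t => if decide (t.2.lamAt t.1 % 4 = 3) then 1 else 3) := hthree.ite (const _ 1) (const _ 3)
  have hbf : CodeFP esE affE (fun t => (⟨false, (List.range t.1).map fun j => t.2.entry t.1 j⟩ : AffForm)) := by
    exact (affMk.comp ((const _ false).pair hb) :)
  -- the odd branch
  have hoddD : CodeFP esE gdE (fun t => GData.addMu (if decide (t.2.lamAt t.1 % 4 = 3) then 3 else 0)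
      (GData.addPhaseForm (if decide (t.2.lamAt t.1 % 4 = 3) then 1 else 3)
        ⟨false, (List.range t.1).map fun j => t.2.entry t.1 j⟩ (GData.restrict t.1 t.2))) := by
    exact (addMu_codeFP.comp (he0.pair (addPhaseForm_codeFP.comp (he1.pair (hbf.pair hD₀)))) :)
  have hoddBr : CodeFP esE (pairE multE gdE) (fun t => (Mult.onePlusI, GData.addMu (if decide (t.2.lamAt t.1 % 4 = 3) then 3 else 0)
      (GData.addPhaseForm (if decide (t.2.lamAt t.1 % 4 = 3) then 1 else 3)
        ⟨false, (List.range t.1).map fun j => t.2.entry t.1 j⟩ (GData.restrict t.1 t.2)))) := (const _ Mult.onePlusI).pair hoddD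
  -- the even branch, `b = 0`
  have hallz : CodeFP esE bitE (fun t => ((List.range t.1).map fun j => t.2.entry t.1 j).all fun x => !x) := by
    have hneg : CodeFP (pairE unitE bitE) bitE (fun q => !q.2) := (snd unitE bitE).not
    exact ((CodeFP.all hneg).comp ((const esE ()).pair hb) :)
  have hzeroBr : CodeFP esE (pairE multE gdE)
      (fun t => (if decide (t.2.lamAt t.1 % 4 = 2) then Mult.zero else Mult.two, GData.restrict t.1 t.2)) :=
    (htwo.ite (const _ Mult.zero) (const _ Mult.two)).pair hD₀
  -- the substitution branch
  have hp : CodeFP esE natE (fun t => firstTrue ((List.range t.1).map fun j => t.2.entry t.1 j)) := firstTrue_codeFP.comp hb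
  have hf : CodeFP esE affE (fun t => (⟨false, ((List.range t.1).map fun j => t.2.entry t.1 j).set
      (firstTrue ((List.range t.1).map fun j => t.2.entry t.1 j)) false⟩ : AffForm).addConst
        (decide (t.2.lamAt t.1 % 4 = 2))) := by
    have hset : CodeFP esE bitsE (fun t => ((List.range t.1).map fun j => t.2.entry t.1 j).set
        (firstTrue ((List.range t.1).map fun j => t.2.entry t.1 j)) false) := by
      exact ((setAt bitE).comp (hb.pair (hp.pair (const _ false))) :)
    exact (affAddConst.comp ((affMk.comp ((const _ false).pair hset)).pair htwo) :)
  have hg : CodeFP esE affE (fun t => GData.colrow t.1 (firstTrue ((List.range t.1).map fun j => t.2.entry t.1 j))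
      (GData.restrict t.1 t.2)) := by
    exact (colrow_codeFP.comp (hkU.pair (hp.pair hD₀)) :)
  have hlamp : CodeFP esE natE (fun t => (GData.restrict t.1 t.2).lamAt (firstTrue ((List.range t.1).map fun j => t.2.entry t.1 j))) := by
    exact (lamAt_codeFP.comp (hD₀.pair hp) :)
  have hsubD : CodeFP esE gdE (fun t =>
      GData.zeroVar (firstTrue ((List.range t.1).map fun j => t.2.entry t.1 j))
        (GData.addQuadProduct
          ((⟨false, ((List.range t.1).map fun j => t.2.entry t.1 j).set
            (firstTrue ((List.range t.1).map fun j => t.2.entry t.1 j)) false⟩ : AffForm).addConst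
              (decide (t.2.lamAt t.1 % 4 = 2)))
          (GData.colrow t.1 (firstTrue ((List.range t.1).map fun j => t.2.entry t.1 j)) (GData.restrict t.1 t.2))
          (GData.addPhaseForm ((GData.restrict t.1 t.2).lamAt (firstTrue ((List.range t.1).map fun j => t.2.entry t.1 j)))
            ((⟨false, ((List.range t.1).map fun j => t.2.entry t.1 j).set
              (firstTrue ((List.range t.1).map fun j => t.2.entry t.1 j)) false⟩ : AffForm).addConst
                (decide (t.2.lamAt t.1 % 4 = 2))) (GData.restrict t.1 t.2)))) := by
    exact (zeroVar_codeFP.comp (hp.pair (addQuadProduct_codeFP.comp (hf.pair (hg.pair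
      (addPhaseForm_codeFP.comp (hlamp.pair (hf.pair hD₀))))))) :)
  have hsubBr := (const esE (eβ := multE) Mult.one).pair hsubD
  refine ((hodd.ite hoddBr (hallz.ite hzeroBr hsubBr))).congr fun t => ?_
  unfold GData.elimStep
  simp only [decide_eq_true_eq]


/-! ### Shapes: sizes of the data along the evaluation -/

/-- A rawE code is bounded by (item bound + 2) per item. [folklore] -/
theorem length_rawE_le_of_forall {α : Type} (e : α → List Bool) (l : List α) (c : ℕ)
    (h : ∀ a ∈ l, (e a).length ≤ c) : (rawE e l).length ≤ l.length * (2 * c + 2) := by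
  induction l with
  | nil => simp
  | cons a l ih =>
    rw [rawE_cons, length_boolPair, List.length_cons]
    have h1 := h a (by simp)
    have h2 := ih (fun x hx => h x (by simp [hx]))
    nlinarith

namespace GData

/-- **Shape bound `K`**: `μ < 4`, `|Λ| ≤ K` with entries `< 4`, at most `K` rows of length `≤ K`.
[folklore] -/
def Sized (K : ℕ) (D : GData) : Prop :=
  D.mu < 4 ∧ D.lam.length ≤ K ∧ (∀ x ∈ D.lam, x < 4) ∧ D.B.length ≤ K ∧ ∀ row ∈ D.B, row.length ≤ K

/-- **Sanitising**: reduce `μ` and `Λ` modulo `4`, truncate to `K` variables and `K` columns (the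
identity on sized data, `sanitize_eq_self`). [folklore] -/
def sanitize (K : ℕ) (D : GData) : GData :=
  ⟨D.mu % 4, (D.lam.take K).map (· % 4), (D.B.take K).map fun row => row.take K⟩

/-- Sanitised data are sized. [folklore] -/
theorem sized_sanitize (K : ℕ) (D : GData) : (sanitize K D).Sized K := by
  refine ⟨Nat.mod_lt _ (by norm_num), ?_, ?_, ?_, ?_⟩
  · simp [sanitize]
  · intro x hx
    simp only [sanitize, List.mem_map] at hx
    obtain ⟨y, _, rfl⟩ := hx
    exact Nat.mod_lt _ (by norm_num)
  · simp [sanitize]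
  · intro row hrow
    simp only [sanitize, List.mem_map] at hrow
    obtain ⟨r, _, rfl⟩ := hrow
    simp

/-- On sized data sanitising does nothing. [folklore] -/
theorem sanitize_eq_self {K : ℕ} {D : GData} (h : D.Sized K) : sanitize K D = D := by
  obtain ⟨h1, h2, h3, h4, h5⟩ := h
  obtain ⟨mu, lam, B⟩ := D
  simp only [sanitize, GData.mk.injEq]
  refine ⟨Nat.mod_eq_of_lt h1, ?_, ?_⟩
  · rw [List.take_of_length_le h2]
    conv_rhs => rw [← List.map_id lam]
    exact List.map_congr_left fun x hx => Nat.mod_eq_of_lt (h3 x hx)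
  · rw [List.take_of_length_le h4]
    conv_rhs => rw [← List.map_id B]
    exact List.map_congr_left fun row hrow => List.take_of_length_le (h5 row hrow)

/-- **The code of sized data is quadratic in `K`**: `|gdE D| ≤ 8K² + 18K + 10`. [folklore] -/
theorem length_gdE_le {K : ℕ} {D : GData} (h : D.Sized K) : (gdE D).length ≤ 8 * K ^ 2 + 18 * K + 10 := by
  obtain ⟨h1, h2, h3, h4, h5⟩ := h
  have hmu : (natE D.mu).length ≤ 3 := (length_natE_le _).trans (by omega)
  have hlam : (natsE D.lam).length ≤ K * 8 := by
    refine (length_rawE_le_of_forall natE D.lam 3 fun x hx => (length_natE_le x).trans (by have := h3 x hx; omega)).trans ?_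
    exact Nat.mul_le_mul h2 le_rfl
  have hrow : ∀ row ∈ D.B, (bitsE row).length ≤ 4 * K := by
    intro row hr
    refine (length_rawE_le_of_forall bitE row 1 fun b _ => le_of_eq rfl).trans ?_
    have := h5 row hr
    omega
  have hB : (rowsE D.B).length ≤ K * (2 * (4 * K) + 2) :=
    (length_rawE_le_of_forall bitsE D.B (4 * K) hrow).trans (Nat.mul_le_mul h4 le_rfl)
  show (pairE natE (pairE natsE rowsE) (D.mu, D.lam, D.B)).length ≤ _
  rw [pairE_apply, length_boolPair, pairE_apply, length_boolPair]
  nlinarith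

/-! ### Shapes are preserved -/

/-- Entries of `addMod4` are reduced. [folklore] -/
theorem lt_four_of_mem_addMod4 (u v : List ℕ) : ∀ x ∈ addMod4 u v, x < 4 := by
  intro x hx
  obtain ⟨j, hj, rfl⟩ := List.getElem_of_mem hx
  have := getD_addMod4 u v j
  rw [List.getD_eq_getElem _ _ hj] at this
  rw [this]
  exact Nat.mod_lt _ (by norm_num)

/-- Rows of `xorRows` are `bxor`s of rows. [folklore] -/
theorem length_row_xorRows_le (U V : List (List Bool)) (c : ℕ) (hU : ∀ r ∈ U, r.length ≤ c)
    (hV : ∀ r ∈ V, r.length ≤ c) : ∀ r ∈ xorRows U V, r.length ≤ c := by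
  intro r hr
  obtain ⟨i, hi, rfl⟩ := List.getElem_of_mem hr
  have := getD_xorRows U V i
  rw [List.getD_eq_getElem _ _ hi] at this
  rw [this, AffForm.length_bxor]
  refine max_le ?_ ?_
  · by_cases h : i < U.length
    · rw [List.getD_eq_getElem _ _ h]; exact hU _ (List.getElem_mem h)
    · rw [List.getD_eq_default _ _ (Nat.not_lt.1 h)]; exact Nat.zero_le _
  · by_cases h : i < V.length
    · rw [List.getD_eq_getElem _ _ h]; exact hV _ (List.getElem_mem h)
    · rw [List.getD_eq_default _ _ (Nat.not_lt.1 h)]; exact Nat.zero_le _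

/-- Rows of `crossRows u v` have length below `|u|`. [folklore] -/
theorem length_row_crossRows_le (u v : List Bool) : ∀ r ∈ crossRows u v, r.length ≤ u.length := by
  intro r hr
  simp only [crossRows, List.mem_map, List.mem_range] at hr
  obtain ⟨i, hi, rfl⟩ := hr
  simp; omega

/-- `addMu` keeps shapes. [folklore] -/
theorem Sized.addMu {K : ℕ} {D : GData} (h : D.Sized K) (e : ℕ) : (GData.addMu e D).Sized K :=
  ⟨Nat.mod_lt _ (by norm_num), h.2.1, h.2.2.1, h.2.2.2.1, h.2.2.2.2⟩

/-- `restrict` makes shapes. [folklore] -/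
theorem Sized.restrict {K : ℕ} {D : GData} (h : D.Sized K) (k : ℕ) : (GData.restrict k D).Sized K := by
  refine ⟨Nat.mod_lt _ (by norm_num), ?_, ?_, ?_, ?_⟩
  · show (D.lam.take k).length ≤ K
    rw [List.length_take]; exact (min_le_right _ _).trans h.2.1
  · exact fun x hx => h.2.2.1 x (List.mem_of_mem_take hx)
  · show (D.B.take k).length ≤ K
    rw [List.length_take]; exact (min_le_right _ _).trans h.2.2.2.1
  · exact fun r hr => h.2.2.2.2 r (List.mem_of_mem_take hr)

/-- `addPhaseForm` with a short form keeps shapes. [folklore] -/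
theorem Sized.addPhaseForm {K : ℕ} {D : GData} (h : D.Sized K) (κ : ℕ) {f : AffForm} (hf : f.a.length ≤ K) :
    (GData.addPhaseForm κ f D).Sized K := by
  obtain ⟨h1, h2, h3, h4, h5⟩ := h
  refine ⟨Nat.mod_lt _ (by norm_num), ?_, lt_four_of_mem_addMod4 _ _, ?_, ?_⟩
  · show (addMod4 D.lam (scaleList _ f.a)).length ≤ K
    rw [length_addMod4, length_scaleList]; exact max_le h2 hf
  · show (if κ % 2 = 1 then xorRows D.B (crossRows f.a f.a) else D.B).length ≤ K
    split
    · rw [length_xorRows, length_crossRows]; exact max_le h4 hf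
    · exact h4
  · show ∀ row ∈ (if κ % 2 = 1 then xorRows D.B (crossRows f.a f.a) else D.B), row.length ≤ K
    split
    · exact length_row_xorRows_le _ _ K h5 fun r hr => (length_row_crossRows_le _ _ r hr).trans hf
    · exact h5

/-- `addQuadProduct` with short forms keeps shapes. [folklore] -/
theorem Sized.addQuadProduct {K : ℕ} {D : GData} (h : D.Sized K) {f g : AffForm} (hf : f.a.length ≤ K)
    (hg : g.a.length ≤ K) : (GData.addQuadProduct f g D).Sized K := by
  obtain ⟨h1, h2, h3, h4, h5⟩ := h
  refine ⟨Nat.mod_lt _ (by norm_num), ?_, lt_four_of_mem_addMod4 _ _, ?_, ?_⟩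
  · show (addMod4 D.lam (quadLin f g)).length ≤ K
    rw [length_addMod4]
    refine max_le h2 ?_
    unfold quadLin; simp; exact ⟨hf, hg⟩
  · show (xorRows D.B (xorRows (crossRows f.a g.a) (crossRows g.a f.a))).length ≤ K
    rw [length_xorRows, length_xorRows, length_crossRows, length_crossRows]
    exact max_le h4 (max_le hf hg)
  · show ∀ row ∈ xorRows D.B (xorRows (crossRows f.a g.a) (crossRows g.a f.a)), row.length ≤ K
    exact length_row_xorRows_le _ _ K h5 (length_row_xorRows_le _ _ K
      (fun r hr => (length_row_crossRows_le _ _ r hr).trans hf)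
      (fun r hr => (length_row_crossRows_le _ _ r hr).trans hg))

/-- `zeroVar` keeps shapes. [folklore] -/
theorem Sized.zeroVar {K : ℕ} {D : GData} (h : D.Sized K) (p : ℕ) : (GData.zeroVar p D).Sized K := by
  obtain ⟨h1, h2, h3, h4, h5⟩ := h
  refine ⟨h1, ?_, ?_, ?_, ?_⟩
  · show (D.lam.set p 0).length ≤ K
    rw [List.length_set]; exact h2
  · show ∀ x ∈ D.lam.set p 0, x < 4
    intro x hx
    rcases List.mem_or_eq_of_mem_set hx with hx | rfl
    · exact h3 x hx
    · norm_num
  · show (D.B.mapIdx _).length ≤ K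
    rw [List.length_mapIdx]; exact h4
  · show ∀ row ∈ D.B.mapIdx (fun l row => if l = p then [] else if p < l then row.set p false else row), row.length ≤ K
    intro row hrow
    rw [mapIdx_eq_map_zip, List.mem_map] at hrow
    obtain ⟨⟨l, r⟩, hmem, rfl⟩ := hrow
    have hr : r ∈ D.B := (List.of_mem_zip hmem).2
    simp only
    split
    · exact Nat.zero_le _
    · split
      · rw [List.length_set]; exact h5 r hr
      · exact h5 r hr

/-- The coupling form `colrow k p` is short. [folklore] -/
theorem length_colrow (k p : ℕ) (D : GData) : (GData.colrow k p D).a.length = k := by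
  simp [GData.colrow]

/-- **`elimStep k` keeps shapes** when `k ≤ K`. [folklore] -/
theorem Sized.elimStep {K k : ℕ} {D : GData} (h : D.Sized K) (hk : k ≤ K) : (GData.elimStep k D).2.Sized K := by
  have hb : ((List.range k).map fun j => D.entry k j).length ≤ K := by simpa using hk
  have hD₀ : (GData.restrict k D).Sized K := h.restrict k
  unfold GData.elimStep
  simp only
  split
  · exact (hD₀.addPhaseForm _ hb).addMu _
  · split
    · exact hD₀
    · refine ((hD₀.addPhaseForm _ ?_).addQuadProduct ?_ ?_).zeroVar _
      · show (List.set _ _ false).length ≤ K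
        rw [List.length_set]; exact hb
      · show (List.set _ _ false).length ≤ K
        rw [List.length_set]; exact hb
      · rw [length_colrow]; exact hk

end GData

/-! ### The evaluator as a counted fold -/

/-- `i^e` as an integer pair. [folklore] -/
def iPowZg (e : ℕ) : ℤ × ℤ :=
  if e % 4 = 0 then (1, 0) else if e % 4 = 1 then (0, 1) else if e % 4 = 2 then (-1, 0) else (0, -1)

/-- `iPowZg` is the pair of `iPowZi`. [folklore] -/
theorem iPowZg_eq (e : ℕ) : iPowZg e = zgOf (iPowZi e) := by
  unfold iPowZg iPowZi
  split
  · rfl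
  · split
    · rfl
    · split <;> rfl

/-- `iPowZg` on codes. [folklore] -/
theorem iPowZg_codeFP : CodeFP natE zgE iPowZg := by
  have hm : CodeFP natE natE (fun e => e % 4) := natMod.comp ((CodeFP.id natE).pair (const _ 4))
  have h0 : CodeFP natE bitE (fun e => decide (e % 4 = 0)) := natEq.comp (hm.pair (const _ 0))
  have h1 : CodeFP natE bitE (fun e => decide (e % 4 = 1)) := natEq.comp (hm.pair (const _ 1))
  have h2 : CodeFP natE bitE (fun e => decide (e % 4 = 2)) := natEq.comp (hm.pair (const _ 2))
  refine (h0.ite (const _ ((1 : ℤ), (0 : ℤ))) (h1.ite (const _ ((0 : ℤ), (1 : ℤ)))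
    (h2.ite (const _ ((-1 : ℤ), (0 : ℤ))) (const _ ((0 : ℤ), (-1 : ℤ)))))).congr fun e => ?_
  unfold iPowZg
  simp only [decide_eq_true_eq]

/-- `zgMul` is associative. [folklore] -/
theorem zgMul_assoc (x y z : ℤ × ℤ) : zgMul (zgMul x y) z = zgMul x (zgMul y z) := by
  unfold zgMul
  refine Prod.ext ?_ ?_ <;> simp only <;> ring

/-- **One counted step**: `(c, D, acc) ↦ (c − 1, (elimStep (c−1) D).2, acc · m)`, nothing at
`c = 0`. [cite: BravyiGosset2016, App. A (ExponentialSum)] -/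
def gStep (st : ℕ × GData × (ℤ × ℤ)) : ℕ × GData × (ℤ × ℤ) :=
  if st.1 = 0 then st else
    (st.1 - 1, (GData.elimStep (st.1 - 1) st.2.1).2, zgMul st.2.2 (GData.elimStep (st.1 - 1) st.2.1).1.toZg)

/-- Iterating past the count does nothing. [folklore] -/
theorem gStep_iterate_zero (n : ℕ) (D : GData) (acc : ℤ × ℤ) : gStep^[n] (0, D, acc) = (0, D, acc) := by
  induction n with
  | zero => rfl
  | succ n ih => rw [Function.iterate_succ_apply, show gStep (0, D, acc) = (0, D, acc) from rfl, ih]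

/-- **Correctness of the counted fold**: after `c` steps from `(c, D, acc)` the count is `0` and the
accumulator times `i^{μ}` of the remaining data is `acc · gaussEval c D`.
[cite: BravyiGosset2016, App. A (ExponentialSum)] -/
theorem gStep_iterate (c : ℕ) : ∀ (D : GData) (acc : ℤ × ℤ),
    (gStep^[c] (c, D, acc)).1 = 0 ∧
      zgMul (gStep^[c] (c, D, acc)).2.2 (iPowZg (gStep^[c] (c, D, acc)).2.1.mu) = zgMul acc (zgOf (GData.gaussEval c D)) := by
  induction c with
  | zero =>
    intro D acc
    refine ⟨rfl, ?_⟩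
    show zgMul acc (iPowZg D.mu) = zgMul acc (zgOf (GData.gaussEval 0 D))
    rw [GData.gaussEval, iPowZg_eq]
  | succ c ih =>
    intro D acc
    rw [Function.iterate_succ_apply]
    have hstep : gStep (c + 1, D, acc) =
        (c, (GData.elimStep c D).2, zgMul acc (GData.elimStep c D).1.toZg) := by
      unfold gStep; simp
    rw [hstep]
    obtain ⟨h1, h2⟩ := ih (GData.elimStep c D).2 (zgMul acc (GData.elimStep c D).1.toZg)
    refine ⟨h1, ?_⟩
    rw [h2, GData.gaussEval, zgOf_mul, Mult.toZg_eq, zgMul_assoc]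

/-- Shapes and accumulator growth along the counted fold: from sized data of at most `K`
variables, after any number of steps the data are sized and the accumulator has grown by a factor
at most `2` per step. [folklore] -/
theorem gStep_iterate_sized {K : ℕ} (n : ℕ) : ∀ (st : ℕ × GData × (ℤ × ℤ)), st.1 ≤ K → st.2.1.Sized K →
    (gStep^[n] st).1 ≤ st.1 ∧ (gStep^[n] st).2.1.Sized K ∧
      (gStep^[n] st).2.2.1.natAbs ≤ 2 ^ n * max st.2.2.1.natAbs st.2.2.2.natAbs ∧
      (gStep^[n] st).2.2.2.natAbs ≤ 2 ^ n * max st.2.2.1.natAbs st.2.2.2.natAbs := by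
  induction n with
  | zero => intro st _ hD; simp only [Function.iterate_zero, id, pow_zero, one_mul]; exact ⟨le_rfl, hD, le_max_left _ _, le_max_right _ _⟩
  | succ n ih =>
    intro st hc hD
    rw [Function.iterate_succ_apply]
    -- one step
    have hone : (gStep st).1 ≤ st.1 ∧ (gStep st).2.1.Sized K ∧
        (gStep st).2.2.1.natAbs ≤ 2 * max st.2.2.1.natAbs st.2.2.2.natAbs ∧
        (gStep st).2.2.2.natAbs ≤ 2 * max st.2.2.1.natAbs st.2.2.2.natAbs := by
      unfold gStep
      split
      · exact ⟨le_rfl, hD, by omega, by omega⟩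
      · refine ⟨by simp, hD.elimStep (by omega), ?_, ?_⟩
        · simp only
          cases (GData.elimStep (st.1 - 1) st.2.1).1 <;> simp only [Mult.toZg, zgMul] <;> omega
        · simp only
          cases (GData.elimStep (st.1 - 1) st.2.1).1 <;> simp only [Mult.toZg, zgMul] <;> omega
    obtain ⟨g1, g2, g3, g4⟩ := hone
    obtain ⟨i1, i2, i3, i4⟩ := ih (gStep st) (g1.trans hc) g2
    refine ⟨i1.trans g1, i2, i3.trans ?_, i4.trans ?_⟩
    · rw [pow_succ]; nlinarith [max_le g3 g4, Nat.zero_le (2 ^ n)]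
    · rw [pow_succ]; nlinarith [max_le g3 g4, Nat.zero_le (2 ^ n)]

/-- The counted fold over a unit list is the iterate. [folklore] -/
theorem foldl_gStep (l : List Unit) (st : ℕ × GData × (ℤ × ℤ)) :
    l.foldl (fun st _ => gStep st) st = gStep^[l.length] st := by
  induction l generalizing st with
  | nil => rfl
  | cons u l ih => rw [List.foldl_cons, ih, List.length_cons, Function.iterate_succ_apply]

/-- The state code of the counted fold. [folklore] -/
abbrev gStateE : ℕ × GData × (ℤ × ℤ) → List Bool := pairE unE (pairE gdE zgE)

/-- `gStep` on codes. [folklore] -/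
theorem gStep_codeFP : CodeFP gStateE gStateE gStep := by
  have hc : CodeFP gStateE unE (fun st => st.1) := fst unE (pairE gdE zgE)
  have hD : CodeFP gStateE gdE (fun st => st.2.1) := (snd unE (pairE gdE zgE)).fst'
  have hacc : CodeFP gStateE zgE (fun st => st.2.2) := (snd unE (pairE gdE zgE)).snd'
  have hz : CodeFP gStateE bitE (fun st => decide (st.1 = 0)) := natEq.comp ((natOfUn.comp hc).pair (const _ 0))
  have hpred : CodeFP gStateE unE (fun st => st.1 - 1) :=
    (unOfNatMin.comp (hc.pair (natSub.comp ((natOfUn.comp hc).pair (const _ 1))))).congr fun st => by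
      simp only [id]; exact min_eq_left (Nat.sub_le _ _)
  have hes : CodeFP gStateE (pairE multE gdE) (fun st => GData.elimStep (st.1 - 1) st.2.1) := by
    exact (elimStep_codeFP.comp (hpred.pair hD) :)
  have hnew : CodeFP gStateE gStateE (fun st => (st.1 - 1, (GData.elimStep (st.1 - 1) st.2.1).2,
      zgMul st.2.2 (GData.elimStep (st.1 - 1) st.2.1).1.toZg)) := by
    exact (hpred.pair (hes.snd'.pair (zgMul_codeFP.comp (hacc.pair (multToZg_codeFP.comp hes.fst')))) :)
  exact (hz.ite (CodeFP.id gStateE) hnew).congr fun st => by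
    unfold gStep; simp only [decide_eq_true_eq]; rfl

/-- Length of the code of a small integer. [folklore] -/
theorem length_intE_le_of_natAbs_le {z : ℤ} {m : ℕ} (h : z.natAbs ≤ 2 ^ m) : (intE z).length ≤ 3 * m + 5 := by
  refine (Brick.length_dpEnc_le z).trans ?_
  have : z.natAbs.size ≤ m + 1 := Nat.size_le.2 (lt_of_le_of_lt h (by
    calc (2:ℕ) ^ m < 2 ^ (m + 1) := Nat.pow_lt_pow_right (by norm_num) (by omega)))
  omega

/-- **The counted fold on codes**, over the budget `1ᴷ` with context `(1ᴷ, D)`: the state after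
the budget. The accumulator bound: from `(1, 0)` the coordinates stay below `2^K`, the data stay
sized (after sanitising), so the state code is quadratic in the input. [cite: AroraBarak2009, §1.3] -/
theorem gFold_codeFP : CodeFP (pairE unE gdE) gStateE
    (fun t => (List.replicate t.1 ()).foldl (fun st _ => gStep st) (t.1, GData.sanitize t.1 t.2, ((1 : ℤ), (0 : ℤ)))) := by
  -- sanitising on codes
  have hsan : CodeFP (pairE unE gdE) gdE (fun t => GData.sanitize t.1 t.2) := by
    have hK : CodeFP (pairE unE gdE) unE (fun t => t.1) := fst unE gdE
    have hD : CodeFP (pairE unE gdE) gdE (fun t => t.2) := snd unE gdE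
    have hmu : CodeFP (pairE unE gdE) natE (fun t => t.2.mu % 4) := by
      exact (natMod.comp ((gdMu.comp hD).pair (const _ 4)) :)
    have hmod : CodeFP natE natE (fun x => x % 4) := natMod.comp ((CodeFP.id natE).pair (const _ 4))
    have hlam : CodeFP (pairE unE gdE) natsE (fun t => (t.2.lam.take t.1).map (· % 4)) := by
      exact ((map₀ hmod).comp ((rawTakeUn natE).comp (hK.pair (gdLam.comp hD))) :)
    have hrow : CodeFP (pairE unE bitsE) bitsE (fun q => q.2.take q.1) := rawTakeUn bitE
    have hB : CodeFP (pairE unE gdE) rowsE (fun t => (t.2.B.take t.1).map fun row => row.take t.1) := by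
      exact ((map hrow).comp (hK.pair ((rawTakeUn bitsE).comp (hK.pair (gdB.comp hD)))) :)
    exact (gdMk.comp (hmu.pair (hlam.pair hB))).congr fun t => rfl
  have hinit : CodeFP (pairE unE gdE) gStateE (fun t => (t.1, GData.sanitize t.1 t.2, ((1 : ℤ), (0 : ℤ)))) :=
    (fst unE gdE).pair (hsan.pair (const _ ((1 : ℤ), (0 : ℤ))))
  have hstep : CodeFP (pairE (pairE unE gdE) (pairE unitE gStateE)) gStateE (fun q => gStep q.2.2) :=
    gStep_codeFP.comp (snd (pairE unE gdE) (pairE unitE gStateE)).snd'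
  have h := foldl (σ := ℕ × GData) (α := Unit) (β := ℕ × GData × (ℤ × ℤ)) (eσ := pairE unE gdE) (eα := unitE)
    (eβ := gStateE) (step := fun _ _ st => gStep st) (init := fun t => (t.1, GData.sanitize t.1 t.2, ((1 : ℤ), (0 : ℤ))))
    hstep hinit (16 * Polynomial.X ^ 2 + 60 * Polynomial.X + 60) (fun t l₁ l₂ => ?_)
  · exact (h.comp ((CodeFP.id (pairE unE gdE)).pair (replicateUnit.comp (fst unE gdE))))
  · -- the bound on the state code
    rw [foldl_gStep]
    set K := t.1 with hK
    obtain ⟨b1, b2, b3, b4⟩ := gStep_iterate_sized (K := K) l₁.length (K, GData.sanitize K t.2, ((1 : ℤ), (0 : ℤ)))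
      le_rfl (GData.sized_sanitize K t.2)
    set st := gStep^[l₁.length] (K, GData.sanitize K t.2, ((1 : ℤ), (0 : ℤ))) with hst
    simp only [Int.natAbs_one, Int.natAbs_zero, max_eq_left (Nat.zero_le 1), mul_one] at b3 b4
    have hX' : (pairE (pairE unE gdE) (rawE unitE) (t, l₁ ++ l₂)).length =
        2 * (2 * K + 2 + (gdE t.2).length) + 2 + (rawE unitE (l₁ ++ l₂)).length := by
      show (boolPair (boolPair (unE t.1) (gdE t.2)) (rawE unitE (l₁ ++ l₂))).length = _
      rw [length_boolPair, length_boolPair, length_unE]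
    have hlen : K ≤ (pairE (pairE unE gdE) (rawE unitE) (t, l₁ ++ l₂)).length := by rw [hX']; omega
    have hl₁ : l₁.length ≤ (pairE (pairE unE gdE) (rawE unitE) (t, l₁ ++ l₂)).length := by
      rw [hX']
      have := length_le_length_rawE unitE (l₁ ++ l₂)
      rw [List.length_append] at this
      omega
    set X := (pairE (pairE unE gdE) (rawE unitE) (t, l₁ ++ l₂)).length with hX
    have e1 : (unE st.1).length ≤ X := by rw [length_unE]; exact b1.trans hlen
    have e2 : (gdE st.2.1).length ≤ 8 * X ^ 2 + 18 * X + 10 :=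
      (GData.length_gdE_le b2).trans (by nlinarith)
    have e3 : (intE st.2.2.1).length ≤ 3 * X + 5 := (length_intE_le_of_natAbs_le b3).trans (by omega)
    have e4 : (intE st.2.2.2).length ≤ 3 * X + 5 := (length_intE_le_of_natAbs_le b4).trans (by omega)
    show (boolPair (unE st.1) (boolPair (gdE st.2.1) (boolPair (intE st.2.2.1) (intE st.2.2.2)))).length ≤ _
    rw [length_boolPair, length_boolPair, length_boolPair]
    simp only [Polynomial.eval_add, Polynomial.eval_mul, Polynomial.eval_pow, Polynomial.eval_X, Polynomial.eval_ofNat]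
    nlinarith

/-- **The evaluator on codes**: `(1ᴷ, D) ↦ gaussEval K (sanitize K D)` as an integer pair.
[cite: BravyiGosset2016, App. A (ExponentialSum, cost O(k³))] -/
theorem gaussEval_codeFP : CodeFP (pairE unE gdE) zgE (fun t => zgOf (GData.gaussEval t.1 (GData.sanitize t.1 t.2))) := by
  have hmu : CodeFP gStateE natE (fun st => st.2.1.mu) := gdMu.comp (snd unE (pairE gdE zgE)).fst'
  have hfin : CodeFP gStateE zgE (fun st => zgMul st.2.2 (iPowZg st.2.1.mu)) := by
    exact (zgMul_codeFP.comp (((snd unE (pairE gdE zgE)).snd').pair (iPowZg_codeFP.comp hmu)) :)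
  refine (hfin.comp gFold_codeFP).congr fun t => ?_
  rw [foldl_gStep, List.length_replicate]
  have h := (gStep_iterate t.1 (GData.sanitize t.1 t.2) ((1 : ℤ), (0 : ℤ))).2
  rw [h]
  unfold zgMul zgOf
  simp

end Literature.Computability.QuantumComplexity.BravyiGosset
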